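import Summits.QuantumFields.BalabanUV.Gaps.EndDrawdownLinearOrbitCriterion

/-!
# Gaps / EndDrawdownLinearBarrier — THE BARRIER CRITERION: possibility of the END statement over the (AF-1) class `|β¹_{k+1}| ≤ C·g_k` is
# EQUIVALENT to the existence, above every level, of a BOUNDED FORWARD SUBSOLUTION of the one-loop recursion with the cooperator's help,
# **`endPossibleLin_iff_barrier`**: `EndPossibleLin b C γ₀ ⟺ ∀ A > 0, ∃ Y ℓ, A ≤ ℓ_i ≤ Y ∧ ℓ_{i+1} ≥ ℓ_i − b_i − C∕√ℓ_i (all i)`.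
# No backward orbit, no realization, no construction, no box, no continuity letter on the right-hand side: a BARRIER `ℓ` is a sequence of
# levels of `1∕g²` that a run may sit on — it absorbs the one-loop drawdown `−b_i` up to the help `C∕√ℓ_i = C·g` the cooperator gives at that level.
# (⟸) every backward orbit of the clamped step map (`EndDrawdownCooperatorExtremal.stepMap`) ending at `Y` stays above `ℓ`, hence above the
# clamp (`orbitsAbove_of_barrier`, comparison for the strictly increasing step map); (⟹) the lower envelope `ℓ_i := inf_{K ≥ i} z^{(K)}_i` of the
# orbits granted by the orbit criterion (`EndDrawdownLinearOrbitCriterion.endPossibleLin_iff_orbits`) IS a barrier (`barrier_of_orbitsAbove`;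
# monotonicity of the step map, no continuity used).  Two instances: DRAWDOWN PATHS are barriers, so GEN 10's floor–entry test holds WITHOUT
# its internal-drawdown datum `Dint` (`endPossibleLin_of_floorEntry'`); and the ORBIT–ENTRY test `endPossibleLin_of_orbitEntry` — run the
# forward recursion WITH the help to a checkpoint, then sit on the tail floor — which counts the cooperator's help during entry.  One necessity in
# barrier language: a barrier crosses a window of rate `≤ −ε` lying below the floor `(C∕ε)²` at speed `≥ ε − C∕√A`, so such windows are SHORT
# (`barrier_window_le`) (cell pub-balaban-gaps, seat g1-p3 GEN 11, rows CAP ∕ tail ∕ (D4) «split ∕ weakening»; this seat's own leaf; file 26 of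
# «the one-loop interface of the END statement»)

HONEST FRAMING (cell rule, page 1 of everything): [folklore] order arguments (a Perron-type sub-solution criterion) over the tree's clamped step map;
`EndPossibleLin` is a quantified READING of the cell's END-grade statement over Bałaban-free data `(b, C, γ₀)`, not a binder; the (AF-1) linear
road is a located UNPRINTED hypothesis shape ([I] (2.12)–(2.14) ∕ [II] p. 8 after (1.29); `CapSignsConstRoad` §1); NOTHING of Bałaban's table is
certified (NODE-O 0∕1, CAP coefficients 0); words ∕ odds of rows CAP ∕ tail ∕ (D4) ∕ (D1) UNCHANGED; 0∕6 binders; one finite T⁴; NOT [I] Thm 2,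
NOT `BetaPertH`, NOT the continuum limit, NOT Clay.

CITATION HEADER (tags CONTEXT ONLY).  [I] = T. Bałaban, Commun. Math. Phys. **109** (1987) 249–301 [Balaban1987RG1]: (0.20) p. 256, Thm 2
p. 259 (first sentence), (2.12)–(2.14) p. 268.
-/

namespace Summit.QuantumFields.BalabanUV.Gaps.EndDrawdownLinearBarrier

open Literature.MathematicalPhysics.QuantumFieldTheory.Balaban1983to89
open Literature.MathematicalPhysics.QuantumFieldTheory.Balaban1983to89.FlowStep
open Literature.MathematicalPhysics.QuantumFieldTheory.Balaban1983to89.FlowStepRuns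
open Literature.MathematicalPhysics.QuantumFieldTheory.Balaban1983to89.DagBinding
open Summit.QuantumFields.BalabanUV.Gaps.EndDrawdownLinearRoad
open Summit.QuantumFields.BalabanUV.Gaps.EndDrawdownCooperatorExtremal
open Summit.QuantumFields.BalabanUV.Gaps.EndDrawdownLinearOrbitCriterion
open Finset

noncomputable section

variable {b : ℕ → ℝ} {C : ℝ}

/-! ## §1 Barriers: bounded forward subsolutions of the helped one-loop recursion -/

/-- A BARRIER for the linear cooperator `(b, C)` between the levels `A ≤ Y`: a sequence `ℓ` of values of `1∕g²` with `A ≤ ℓ_i ≤ Y` and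
`ℓ_{i+1} ≥ ℓ_i − b_i − C∕√ℓ_i` — it rises at least as fast as the one-loop drawdown net of the help `C·g = C∕√ℓ` the cooperator gives AT the
barrier.  A forward SUBSOLUTION; a property of `(b, C, A, Y, ℓ)` alone. [folklore] -/
def IsBarrier (b : ℕ → ℝ) (C A Y : ℝ) (ℓ : ℕ → ℝ) : Prop :=
  (∀ i, A ≤ ℓ i) ∧ (∀ i, ℓ i ≤ Y) ∧ ∀ i, ℓ i - b i - C / Real.sqrt (ℓ i) ≤ ℓ (i + 1)

/-- A barrier above `A` is a barrier above every `A' ≤ A`. [folklore] -/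
theorem IsBarrier.mono_level {A A' Y : ℝ} {ℓ : ℕ → ℝ} (h : IsBarrier b C A Y ℓ) (hA : A' ≤ A) : IsBarrier b C A' Y ℓ :=
  ⟨fun i => hA.trans (h.1 i), h.2.1, h.2.2⟩

/-- A barrier below `Y` is a barrier below every `Y' ≥ Y`. [folklore] -/
theorem IsBarrier.mono_top {A Y Y' : ℝ} {ℓ : ℕ → ℝ} (h : IsBarrier b C A Y ℓ) (hY : Y ≤ Y') : IsBarrier b C A Y' ℓ :=
  ⟨h.1, fun i => (h.2.1 i).trans hY, h.2.2⟩

/-- The levels of a barrier are ordered: `A ≤ Y`. [folklore] -/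
theorem IsBarrier.level_le {A Y : ℝ} {ℓ : ℕ → ℝ} (h : IsBarrier b C A Y ℓ) : A ≤ Y := (h.1 0).trans (h.2.1 0)

/-- Above the clamp the step map of the linear cooperator is the helped recursion: `F_i(y) = y − b_i − C∕√y` for `y ≥ 1∕γ²`. [folklore] -/
theorem stepMap_lin_of_le {γ : ℝ} (i : ℕ) {y : ℝ} (hy : 1 / γ ^ 2 ≤ y) :
    stepMap b (fun x => C * x) γ i y = y - b i - C / Real.sqrt y := by
  rw [stepMap_apply, gClamp_eq_of_le hy, mul_one_div]

/-- The step map of the linear cooperator (`C ≥ 0`) is non-decreasing. [folklore] -/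
theorem stepMap_lin_mono {γ : ℝ} (hγ : 0 < γ) (hC : 0 ≤ C) (i : ℕ) {u v : ℝ} (h : u ≤ v) :
    stepMap b (fun x => C * x) γ i u ≤ stepMap b (fun x => C * x) γ i v := by
  have := sub_le_stepMap_sub (b := b) hγ (monotoneOn_linHelp hC γ) i h
  linarith

/-! ## §2 The criterion -/

/-- **ORBITS SIT ON BARRIERS** · a barrier between `1∕γ²` and `Y` keeps EVERY backward orbit of the clamped step map ending at `Y` (every horizon)
above itself, hence above the clamp: `OrbitsAbove b (C·) γ Y` (`C ≥ 0`).  Backward induction: `z_{i+1} ≥ ℓ_{i+1} ≥ F_i(ℓ_i)` and `F_i` strictly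
increasing give `z_i ≥ ℓ_i`. [folklore] -/
theorem orbitsAbove_of_barrier {γ Y : ℝ} (hγ : 0 < γ) (hC : 0 ≤ C) {ℓ : ℕ → ℝ} (hℓ : IsBarrier b C (1 / γ ^ 2) Y ℓ) :
    OrbitsAbove b (fun x => C * x) γ Y := by
  intro K z hzK hz
  suffices h : ∀ d i, i + d = K → ℓ i ≤ z i from fun i hi => (hℓ.1 i).trans (h (K - i) i (by omega))
  intro d
  induction d with
  | zero => intro i hi; rw [show i = K by omega, hzK]; exact hℓ.2.1 K
  | succ d ih =>
    intro i hi
    have h1 : ℓ (i + 1) ≤ z (i + 1) := ih (i + 1) (by omega)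
    have h2 : stepMap b (fun x => C * x) γ i (ℓ i) ≤ stepMap b (fun x => C * x) γ i (z i) := by
      rw [hz i (by omega), stepMap_lin_of_le i (hℓ.1 i)]
      exact (hℓ.2.2 i).trans h1
    exact le_of_stepMap_le (b := b) hγ (monotoneOn_linHelp hC γ) i h2

/-- **THE LOWER ENVELOPE OF THE ORBITS IS A BARRIER** · if some terminal level `Y` has all its backward orbits above the clamp
(`OrbitsAbove b (C·) γ Y`, `C ≥ 0`), then `ℓ_i := inf_{K ≥ i} z^{(K)}_i` (orbits `z^{(K)}` ending at `z^{(K)}_K = Y`) is a barrier between `1∕γ²`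
and `Y`: `ℓ_i ≤ z^{(i)}_i = Y`, and `z^{(K)}_{i+1} = F_i(z^{(K)}_i) ≥ F_i(ℓ_i) = ℓ_i − b_i − C∕√ℓ_i` for every `K ≥ i+1` (monotone `F_i`). [folklore] -/
theorem barrier_of_orbitsAbove {γ Y : ℝ} (hγ : 0 < γ) (hC : 0 ≤ C) (h : OrbitsAbove b (fun x => C * x) γ Y) : ∃ ℓ : ℕ → ℝ, IsBarrier b C (1 / γ ^ 2) Y ℓ := by
  choose z hzK hz using fun K => exists_backOrbit (b := b) (H := fun x => C * x) hγ (continuousOn_linHelp C γ)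
    (monotoneOn_linHelp hC γ) K Y
  have hzlow : ∀ K i, i ≤ K → 1 / γ ^ 2 ≤ z K i := fun K i hi => h K (z K) (hzK K) (hz K) i hi
  -- the lower envelope over the horizons `K ≥ i`
  let ℓ : ℕ → ℝ := fun i => ⨅ K : {K : ℕ // i ≤ K}, z K.1 i
  have hbdd : ∀ i, BddBelow (Set.range fun K : {K : ℕ // i ≤ K} => z K.1 i) := fun i =>
    ⟨1 / γ ^ 2, by rintro _ ⟨K, rfl⟩; exact hzlow K.1 i K.2⟩
  have hℓle : ∀ i (K : ℕ) (hK : i ≤ K), ℓ i ≤ z K i := fun i K hK => ciInf_le (hbdd i) ⟨K, hK⟩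
  have hℓge : ∀ i, 1 / γ ^ 2 ≤ ℓ i := fun i => by
    haveI : Nonempty {K : ℕ // i ≤ K} := ⟨⟨i, le_rfl⟩⟩
    exact le_ciInf fun K => hzlow K.1 i K.2
  refine ⟨ℓ, hℓge, fun i => (hℓle i i le_rfl).trans (hzK i).le, fun i => ?_⟩
  haveI : Nonempty {K : ℕ // i + 1 ≤ K} := ⟨⟨i + 1, le_rfl⟩⟩
  refine le_ciInf fun K => ?_
  have hstep : stepMap b (fun x => C * x) γ i (ℓ i) ≤ stepMap b (fun x => C * x) γ i (z K.1 i) :=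
    stepMap_lin_mono hγ hC i (hℓle i K.1 (by have := K.2; omega))
  rw [stepMap_lin_of_le i (hℓge i), hz K.1 i (by have := K.2; omega)] at hstep
  exact hstep

/-- **THE BARRIER CRITERION** · `EndPossibleLin b C γ₀ ⟺ ∀ A > 0, ∃ Y ℓ, IsBarrier b C A Y ℓ` (`C ≥ 0`, `γ₀ > 0`): possibility of the END
statement over the whole (AF-1) class `|β¹_{k+1}| ≤ C g_k` is the existence, above EVERY level, of a bounded forward subsolution
`ℓ_{i+1} ≥ ℓ_i − b_i − C∕√ℓ_i` — nothing else.  (⟹) orbit criterion + lower envelope; (⟸) orbits sit on barriers (box `γ₂ = 1`, level `1∕γ²`).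
[cite: Balaban1987RG1, Thm 2 p.259 (first sentence) and (2.12)–(2.14) p.268] -/
theorem endPossibleLin_iff_barrier (hC : 0 ≤ C) {γ₀ : ℝ} (hγ₀ : 0 < γ₀) :
    EndPossibleLin b C γ₀ ↔ ∀ A : ℝ, 0 < A → ∃ (Y : ℝ) (ℓ : ℕ → ℝ), IsBarrier b C A Y ℓ := by
  rw [endPossibleLin_iff_orbits hC hγ₀]
  constructor
  · rintro ⟨γ₂, hγ₂, h⟩ A hA
    set γ : ℝ := min γ₂ (1 / Real.sqrt A) with hγdef
    have hγpos : 0 < γ := lt_min hγ₂ (by positivity)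
    obtain ⟨Y, -, hO⟩ := h γ hγpos (min_le_left _ _)
    obtain ⟨ℓ, hℓ⟩ := barrier_of_orbitsAbove hγpos hC hO
    refine ⟨Y, ℓ, hℓ.mono_level ?_⟩
    -- `A ≤ 1∕γ²` since `γ ≤ 1∕√A`
    have h1 : γ ≤ 1 / Real.sqrt A := min_le_right _ _
    have h2 : γ ^ 2 ≤ (1 / Real.sqrt A) ^ 2 := pow_le_pow_left₀ hγpos.le h1 2
    rw [div_pow, one_pow, Real.sq_sqrt hA.le] at h2
    calc A = 1 / (1 / A) := (one_div_one_div A).symm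
      _ ≤ 1 / γ ^ 2 := one_div_le_one_div_of_le (pow_pos hγpos 2) h2
  · intro h
    refine ⟨1, one_pos, fun γ hγ _ => ?_⟩
    obtain ⟨Y, ℓ, hℓ⟩ := h (1 / γ ^ 2) (by positivity)
    exact ⟨Y, hℓ.level_le, orbitsAbove_of_barrier hγ hC hℓ⟩

/-- … with the levels along any sequence tending to `+∞` (barriers descend to lower levels). [folklore] -/
theorem endPossibleLin_iff_barrier_seq (hC : 0 ≤ C) {γ₀ : ℝ} (hγ₀ : 0 < γ₀) {A : ℕ → ℝ}
    (hA : Filter.Tendsto A Filter.atTop Filter.atTop) :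
    EndPossibleLin b C γ₀ ↔ ∀ n : ℕ, ∃ (Y : ℝ) (ℓ : ℕ → ℝ), IsBarrier b C (A n) Y ℓ := by
  rw [endPossibleLin_iff_barrier hC hγ₀]
  constructor
  · intro h n
    obtain ⟨Y, ℓ, hℓ⟩ := h (max (A n) 1) (lt_max_of_lt_right one_pos)
    exact ⟨Y, ℓ, hℓ.mono_level (le_max_left _ _)⟩
  · intro h A' _
    obtain ⟨n, hn⟩ := (Filter.tendsto_atTop_atTop.mp hA) A'
    obtain ⟨Y, ℓ, hℓ⟩ := h n
    exact ⟨Y, ℓ, hℓ.mono_level (hn n le_rfl)⟩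

/-- **IMPOSSIBILITY IN BARRIER LANGUAGE** · `¬ EndPossibleLin b C γ₀ ⟺ ∃ A > 0` above which NO bounded subsolution exists (`C ≥ 0`, `γ₀ > 0`).
[cite: Balaban1987RG1, Thm 2 p.259 (first sentence) and (2.12)–(2.14) p.268] -/
theorem not_endPossibleLin_iff_noBarrier (hC : 0 ≤ C) {γ₀ : ℝ} (hγ₀ : 0 < γ₀) :
    ¬ EndPossibleLin b C γ₀ ↔ ∃ A : ℝ, 0 < A ∧ ∀ (Y : ℝ) (ℓ : ℕ → ℝ), ¬ IsBarrier b C A Y ℓ := by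
  rw [endPossibleLin_iff_barrier hC hγ₀]
  push Not
  rfl

/-! ## §3 Two instances: drawdown paths (floor–entry without `Dint`) and the ORBIT–ENTRY test -/

/-- **DRAWDOWN PATHS ARE SUBSOLUTIONS** · a sequence rising at least as fast as the one-loop drawdown, `ℓ_{i+1} ≥ ℓ_i − b_i`, with `ℓ ≥ 0`,
satisfies the barrier inequality for every `C ≥ 0` (the help only lowers the requirement). [folklore] -/
theorem barrier_step_of_drawdown (hC : 0 ≤ C) {ℓ : ℕ → ℝ} (hpos : ∀ i, 0 ≤ ℓ i) (h : ∀ i, ℓ i - b i ≤ ℓ (i + 1)) (i : ℕ) :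
    ℓ i - b i - C / Real.sqrt (ℓ i) ≤ ℓ (i + 1) := by
  have : 0 ≤ C / Real.sqrt (ℓ i) := div_nonneg hC (Real.sqrt_nonneg _)
  have := hpos i
  linarith [h i]

/-- **THE FLOOR OF A RATE IS A SUBSOLUTION** · at a step with `b_i ≥ −ρ` (`ρ > 0`), every level `0 < y ≤ (C∕ρ)²` satisfies `y − b_i − C∕√y ≤ y`
(the help `C∕√y ≥ ρ` beats the rate), so constants below the floor `(C∕ρ)²` are barriers there. [folklore] -/
theorem floor_step {ρ y : ℝ} (hC : 0 < C) (hρ : 0 < ρ) {i : ℕ} (hb : -ρ ≤ b i) (hy : 0 < y) (hyΛ : y ≤ (C / ρ) ^ 2) :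
    y - b i - C / Real.sqrt y ≤ y := by
  have hsq : Real.sqrt y ≤ C / ρ := by
    rw [← Real.sqrt_sq (show 0 ≤ C / ρ by positivity)]
    exact Real.sqrt_le_sqrt hyΛ
  have hspos : 0 < Real.sqrt y := Real.sqrt_pos.mpr hy
  have hhelp : ρ ≤ C / Real.sqrt y := by
    rw [le_div_iff₀ hspos]
    calc ρ * Real.sqrt y ≤ ρ * (C / ρ) := mul_le_mul_of_nonneg_left hsq hρ.le
      _ = C := by field_simp
  linarith

/-- **THE FLOOR–ENTRY BARRIER (no internal-drawdown datum)** · data: a checkpoint `I`, a tail rate `ρ > 0` (`b_j ≥ −ρ` for `j ≥ I`), an ENTRY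
drawdown bound `Dent` for the windows ending at `I` (`Σ_{[i,I)} b ≥ −Dent`, `i ≤ I`), and `A + Dent ≤ (C∕ρ)²` (`A > 0`).  Then
`ℓ_i := A + Dent + Σ_{[i,I)} b` for `i ≤ I`, `ℓ_i := A + Dent` for `i ≥ I`, is a barrier between `A` and `max_{i ≤ I} ℓ_i`: a drawdown path into the
checkpoint, then the floor.  GEN 10's `Dint` (windows inside `[0,I]`) is NOT needed. [folklore] -/
theorem barrier_of_floorEntry (hC : 0 < C) {A : ℝ} (hA : 0 < A) {I : ℕ} {ρ Dent : ℝ} (hρ : 0 < ρ)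
    (htail : ∀ j, I ≤ j → -ρ ≤ b j) (hent : ∀ i, i ≤ I → -Dent ≤ ∑ j ∈ Ico i I, b j) (hfloor : A + Dent ≤ (C / ρ) ^ 2) :
    ∃ (Y : ℝ) (ℓ : ℕ → ℝ), IsBarrier b C A Y ℓ := by
  have hDent : 0 ≤ Dent := by have h := hent I le_rfl; simp at h; linarith
  let ℓ : ℕ → ℝ := fun i => A + Dent + ∑ j ∈ Ico i I, b j
  have hℓI : ∀ i, I ≤ i → ℓ i = A + Dent := fun i hi => by
    show A + Dent + ∑ j ∈ Ico i I, b j = A + Dent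
    rw [Finset.Ico_eq_empty (by omega), Finset.sum_empty, add_zero]
  have hℓlow : ∀ i, A ≤ ℓ i := fun i => by
    by_cases hi : i ≤ I
    · show A ≤ A + Dent + ∑ j ∈ Ico i I, b j; linarith [hent i hi]
    · rw [hℓI i (by omega)]; linarith
  -- a finite bound for the entry segment
  obtain ⟨Y, hY⟩ : ∃ Y : ℝ, ∀ i, ℓ i ≤ Y := by
    refine ⟨(A + Dent) + ∑ j ∈ range I, |b j|, fun i => ?_⟩
    show A + Dent + ∑ j ∈ Ico i I, b j ≤ A + Dent + ∑ j ∈ range I, |b j|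
    have h1 : ∑ j ∈ Ico i I, b j ≤ ∑ j ∈ Ico i I, |b j| := Finset.sum_le_sum fun j _ => le_abs_self _
    have h2 : ∑ j ∈ Ico i I, |b j| ≤ ∑ j ∈ range I, |b j| :=
      Finset.sum_le_sum_of_subset_of_nonneg (fun j hj => by simp only [mem_Ico] at hj; simp only [mem_range]; omega)
        fun _ _ _ => abs_nonneg _
    linarith
  refine ⟨Y, ℓ, hℓlow, hY, fun i => ?_⟩
  by_cases hi : i < I
  · -- drawdown step into the checkpoint
    have hstep : ℓ i - b i = ℓ (i + 1) := by
      show A + Dent + ∑ j ∈ Ico i I, b j - b i = A + Dent + ∑ j ∈ Ico (i + 1) I, b j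
      rw [Finset.sum_eq_sum_Ico_succ_bot hi]; ring
    have h0 : 0 ≤ C / Real.sqrt (ℓ i) := div_nonneg hC.le (Real.sqrt_nonneg _)
    linarith
  · -- on the floor
    rw [hℓI i (by omega), hℓI (i + 1) (by omega)]
    exact floor_step hC hρ (htail i (by omega)) (by positivity) hfloor

/-- **POSSIBLE ON THE LINEAR ROAD FROM THE FLOOR–ENTRY CONDITION WITHOUT `Dint`** (`C > 0`, every box): if for every level `A > 0` the one-loop
sequence `b` admits a checkpoint `I`, a tail rate `ρ > 0` (`b_j ≥ −ρ`, `j ≥ I`) and an entry drawdown bound `Dent` with `A + Dent ≤ (C∕ρ)²`, then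
`EndPossibleLin b C γ₀` — GEN 10's `EndDrawdownLinearFloorEntry.endPossibleLin_of_floorEntry` with its third datum dropped.
[cite: Balaban1987RG1, Thm 2 p.259 (first sentence) and (2.12)–(2.14) p.268] -/
theorem endPossibleLin_of_floorEntry' (hC : 0 < C) {γ₀ : ℝ} (hγ₀ : 0 < γ₀)
    (h : ∀ A : ℝ, 0 < A → ∃ (I : ℕ) (ρ Dent : ℝ), 0 < ρ ∧ (∀ j, I ≤ j → -ρ ≤ b j) ∧
      (∀ i, i ≤ I → -Dent ≤ ∑ j ∈ Ico i I, b j) ∧ A + Dent ≤ (C / ρ) ^ 2) :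
    EndPossibleLin b C γ₀ :=
  (endPossibleLin_iff_barrier hC.le hγ₀).mpr fun A hA => by
    obtain ⟨I, ρ, Dent, hρ, htail, hent, hfloor⟩ := h A hA
    exact barrier_of_floorEntry hC hA hρ htail hent hfloor

/-- THE HELPED FORWARD RECURSION from `x₀`: `x_{i+1} = x_i − b_i − C∕√x_i` (the unclamped forward orbit of the linear cooperator in the variable
`1∕g²`). [folklore] -/
def fwdOrbit (b : ℕ → ℝ) (C x₀ : ℝ) : ℕ → ℝ
  | 0 => x₀
  | i + 1 => fwdOrbit b C x₀ i - b i - C / Real.sqrt (fwdOrbit b C x₀ i)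

/-- Unfolding at `0`. [folklore] -/
@[simp] theorem fwdOrbit_zero (x₀ : ℝ) : fwdOrbit b C x₀ 0 = x₀ := rfl

/-- Unfolding at a successor. [folklore] -/
theorem fwdOrbit_succ (x₀ : ℝ) (i : ℕ) :
    fwdOrbit b C x₀ (i + 1) = fwdOrbit b C x₀ i - b i - C / Real.sqrt (fwdOrbit b C x₀ i) := rfl

/-- **THE ORBIT–ENTRY BARRIER** · data at level `A > 0`: a start `x₀`, a checkpoint `I` and a tail rate `ρ > 0` (`b_j ≥ −ρ` for `j ≥ I`) such that
the helped forward recursion from `x₀` stays `≥ A` up to `I` and ENTERS the tail floor there, `x_I ≤ (C∕ρ)²`.  Then `ℓ := x` on `[0, I]`, `ℓ := (C∕ρ)²`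
beyond, is a barrier above `A` — the cooperator's help is COUNTED during entry (the drawdown path of `barrier_of_floorEntry` ignores it). [folklore] -/
theorem barrier_of_orbitEntry (hC : 0 < C) {A x₀ : ℝ} (hA : 0 < A) {I : ℕ} {ρ : ℝ} (hρ : 0 < ρ)
    (htail : ∀ j, I ≤ j → -ρ ≤ b j) (hlow : ∀ i, i ≤ I → A ≤ fwdOrbit b C x₀ i) (hent : fwdOrbit b C x₀ I ≤ (C / ρ) ^ 2) :
    ∃ (Y : ℝ) (ℓ : ℕ → ℝ), IsBarrier b C A Y ℓ := by
  set Λ : ℝ := (C / ρ) ^ 2 with hΛ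
  let ℓ : ℕ → ℝ := fun i => if i ≤ I then fwdOrbit b C x₀ i else Λ
  have hAΛ : A ≤ Λ := (hlow I le_rfl).trans hent
  -- a finite bound for the entry segment
  obtain ⟨M, hM⟩ : ∃ M : ℝ, ∀ i, i ≤ I → fwdOrbit b C x₀ i ≤ M :=
    ⟨(range (I + 1)).sup' ⟨0, by simp⟩ fun i => fwdOrbit b C x₀ i, fun i hi =>
      Finset.le_sup' (fun i => fwdOrbit b C x₀ i) (by simp only [mem_range]; omega)⟩
  refine ⟨max Λ M, ℓ, fun i => ?_, fun i => ?_, fun i => ?_⟩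
  · by_cases hi : i ≤ I
    · show A ≤ (if i ≤ I then fwdOrbit b C x₀ i else Λ); rw [if_pos hi]; exact hlow i hi
    · show A ≤ (if i ≤ I then fwdOrbit b C x₀ i else Λ); rw [if_neg hi]; exact hAΛ
  · by_cases hi : i ≤ I
    · show (if i ≤ I then fwdOrbit b C x₀ i else Λ) ≤ max Λ M; rw [if_pos hi]; exact (hM i hi).trans (le_max_right _ _)
    · show (if i ≤ I then fwdOrbit b C x₀ i else Λ) ≤ max Λ M; rw [if_neg hi]; exact le_max_left _ _
  · show (if i ≤ I then fwdOrbit b C x₀ i else Λ) - b i - C / Real.sqrt (if i ≤ I then fwdOrbit b C x₀ i else Λ) ≤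
      (if i + 1 ≤ I then fwdOrbit b C x₀ (i + 1) else Λ)
    rcases lt_trichotomy (i + 1) I with hlt | heq | hgt
    · -- inside the entry segment: the recursion itself
      rw [if_pos (by omega), if_pos hlt.le, fwdOrbit_succ]
    · -- `i + 1 = I`: still the recursion
      rw [if_pos (by omega), if_pos heq.le, fwdOrbit_succ]
    · by_cases hi : i ≤ I
      · -- `i = I`: from `x_I ≤ Λ` the help is `≥ ρ ≥ −b_I`
        have hiI : i = I := by omega
        rw [if_pos hi, if_neg (by omega), hiI]
        have hx : 0 < fwdOrbit b C x₀ I := hA.trans_le (hlow I le_rfl)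
        have := floor_step hC hρ (htail I le_rfl) hx hent
        linarith
      · -- on the floor
        rw [if_neg hi, if_neg (by omega)]
        exact floor_step hC hρ (htail i (by omega)) (hA.trans_le hAΛ) le_rfl

/-- **POSSIBLE ON THE LINEAR ROAD FROM THE ORBIT–ENTRY TEST** (`C > 0`, every box): if at every level `A > 0` some helped forward orbit stays
`≥ A` until it enters a tail floor, then `EndPossibleLin b C γ₀`. [cite: Balaban1987RG1, Thm 2 p.259 (first sentence) and (2.12)–(2.14) p.268] -/
theorem endPossibleLin_of_orbitEntry (hC : 0 < C) {γ₀ : ℝ} (hγ₀ : 0 < γ₀)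
    (h : ∀ A : ℝ, 0 < A → ∃ (x₀ : ℝ) (I : ℕ) (ρ : ℝ), 0 < ρ ∧ (∀ j, I ≤ j → -ρ ≤ b j) ∧
      (∀ i, i ≤ I → A ≤ fwdOrbit b C x₀ i) ∧ fwdOrbit b C x₀ I ≤ (C / ρ) ^ 2) :
    EndPossibleLin b C γ₀ :=
  (endPossibleLin_iff_barrier hC.le hγ₀).mpr fun A hA => by
    obtain ⟨x₀, I, ρ, hρ, htail, hlow, hent⟩ := h A hA
    exact barrier_of_orbitEntry hC hA hρ htail hlow hent

/-- **THE FORWARD ORBIT LIES BELOW EVERY BARRIER ISSUED FROM ITS START** · if `ℓ` is a barrier above `A > 0`, the helped forward orbit from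
`x₀ = ℓ_0` satisfies `x_i ≤ ℓ_i` as long as it stays `≥ A` (comparison for the non-decreasing map `y ↦ y − C∕√y` on `y > 0`): a barrier is an UPPER
envelope of the orbit issued from its foot — the orbit is the LEAST continuation, so the orbit–entry test is the sharpest barrier of its shape. [folklore] -/
theorem fwdOrbit_le_barrier (hC : 0 ≤ C) {A Y : ℝ} (hA : 0 < A) {ℓ : ℕ → ℝ} (hℓ : IsBarrier b C A Y ℓ) {n : ℕ}
    (hlow : ∀ i, i < n → A ≤ fwdOrbit b C (ℓ 0) i) : ∀ i, i ≤ n → fwdOrbit b C (ℓ 0) i ≤ ℓ i := by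
  intro i hi
  induction i with
  | zero => simp
  | succ i ih =>
    have hxi : fwdOrbit b C (ℓ 0) i ≤ ℓ i := ih (by omega)
    have hxpos : 0 < fwdOrbit b C (ℓ 0) i := hA.trans_le (hlow i (by omega))
    have hℓpos : 0 < ℓ i := hA.trans_le (hℓ.1 i)
    -- `y ↦ y − C∕√y` is non-decreasing on `y > 0`
    have hmono : fwdOrbit b C (ℓ 0) i - C / Real.sqrt (fwdOrbit b C (ℓ 0) i) ≤ ℓ i - C / Real.sqrt (ℓ i) := by
      have hs : Real.sqrt (fwdOrbit b C (ℓ 0) i) ≤ Real.sqrt (ℓ i) := Real.sqrt_le_sqrt hxi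
      have hs0 : 0 < Real.sqrt (fwdOrbit b C (ℓ 0) i) := Real.sqrt_pos.mpr hxpos
      have h1 : C / Real.sqrt (ℓ i) ≤ C / Real.sqrt (fwdOrbit b C (ℓ 0) i) :=
        div_le_div_of_nonneg_left hC hs0 hs
      -- both `y` and `−C∕√y` are non-decreasing in `y`
      linarith
    rw [fwdOrbit_succ]
    linarith [hℓ.2.2 i]

/-! ## §4 One necessity in barrier language: deep windows below their floor are short -/

/-- **BARRIERS CROSS DEEP LOW WINDOWS FAST** · if `ℓ` is a barrier between `A > 0` and `Y`, and on the window `[m, n)` the one-loop coefficients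
satisfy `b_j ≤ −ε` with `ε·√A > C` (the window lies below the floor of its rate as seen from level `A`), then the barrier rises by at least
`ε − C∕√A > 0` per step there, so `(n − m)·(ε − C∕√A) ≤ Y − A`: such windows are SHORT.  (The multi-scale form of this remark is GEN 10's
descending-staircase obstruction `EndDrawdownLinearCeiling`.) [folklore] -/
theorem barrier_window_le {A Y ε : ℝ} (hA : 0 < A) (hC : 0 ≤ C) {ℓ : ℕ → ℝ} (hℓ : IsBarrier b C A Y ℓ) {m n : ℕ} (hmn : m ≤ n)
    (hdeep : ∀ j, m ≤ j → j < n → b j ≤ -ε) :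
    ((n - m : ℕ) : ℝ) * (ε - C / Real.sqrt A) ≤ Y - A := by
  -- per-step gain `ε − C∕√A`
  have hgain : ∀ j, m ≤ j → j < n → ℓ j + (ε - C / Real.sqrt A) ≤ ℓ (j + 1) := by
    intro j hj1 hj2
    have h1 := hℓ.2.2 j
    have h2 : C / Real.sqrt (ℓ j) ≤ C / Real.sqrt A :=
      div_le_div_of_nonneg_left hC (Real.sqrt_pos.mpr hA) (Real.sqrt_le_sqrt (hℓ.1 j))
    linarith [hdeep j hj1 hj2]
  have hsum : ∀ d, m + d ≤ n → ℓ m + d * (ε - C / Real.sqrt A) ≤ ℓ (m + d) := by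
    intro d
    induction d with
    | zero => intro _; simp
    | succ d ih =>
      intro hd
      have h1 := ih (by omega)
      have h2 := hgain (m + d) (by omega) (by omega)
      rw [show m + (d + 1) = m + d + 1 by omega]
      push_cast
      linarith
  have h := hsum (n - m) (by omega)
  rw [show m + (n - m) = n by omega] at h
  linarith [hℓ.1 m, hℓ.2.1 n]

/-! ## §5 (v1.1, append-only) Stability in barrier language: summable extra drawdown is absorbed by lowering the barrier by the budget -/

/-- **BARRIERS ABSORB SUMMABLE LOSSES** · if `ℓ` is a barrier for `(b, C)` between `A + D` and `Y` (`A > 0`), and `δ ≥ 0` has partial sums `≤ D`, then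
`ℓ_i − D + Σ_{j<i} δ_j` is a barrier for `(b − δ, C)` between `A` and `Y` (`C ≥ 0`): the lowered barrier rises by the extra drawdown, and the help at the
LOWER level is only larger.  The barrier-language proof of GEN 10's `EndDrawdownLinearCeiling.endPossibleLin_perturb`. [folklore] -/
theorem IsBarrier.perturb (hC : 0 ≤ C) {A D Y : ℝ} (hA : 0 < A) {ℓ : ℕ → ℝ} (hℓ : IsBarrier b C (A + D) Y ℓ) {δ : ℕ → ℝ} (hδ : ∀ j, 0 ≤ δ j)
    (hD : ∀ n, ∑ j ∈ range n, δ j ≤ D) :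
    IsBarrier (fun i => b i - δ i) C A Y (fun i => ℓ i - D + ∑ j ∈ range i, δ j) := by
  refine ⟨fun i => by linarith [hℓ.1 i, Finset.sum_nonneg fun j (_ : j ∈ range i) => hδ j],
    fun i => by linarith [hℓ.2.1 i, hD i], fun i => ?_⟩
  have hsum : ∑ j ∈ range (i + 1), δ j = ∑ j ∈ range i, δ j + δ i := Finset.sum_range_succ _ _
  have hlow : A ≤ ℓ i - D + ∑ j ∈ range i, δ j := by linarith [hℓ.1 i, Finset.sum_nonneg fun j (_ : j ∈ range i) => hδ j]
  have hpos : 0 < ℓ i - D + ∑ j ∈ range i, δ j := hA.trans_le hlow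
  have hle : ℓ i - D + ∑ j ∈ range i, δ j ≤ ℓ i := by linarith [hD i]
  have hhelp : C / Real.sqrt (ℓ i) ≤ C / Real.sqrt (ℓ i - D + ∑ j ∈ range i, δ j) :=
    div_le_div_of_nonneg_left hC (Real.sqrt_pos.mpr hpos) (Real.sqrt_le_sqrt hle)
  have hstep := hℓ.2.2 i
  show ℓ i - D + ∑ j ∈ range i, δ j - (b i - δ i) - C / Real.sqrt (ℓ i - D + ∑ j ∈ range i, δ j) ≤
    ℓ (i + 1) - D + ∑ j ∈ range (i + 1), δ j
  rw [hsum]; linarith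

/-- **SUMMABLE LOSSES KEEP POSSIBILITY** (barrier proof; `C ≥ 0`, every box): `EndPossibleLin b C γ₀ ⟹ EndPossibleLin (b − δ) C γ₀` for `δ ≥ 0` with
partial sums `≤ D` — take the `b`-barrier above `A + D` and lower it by the unused budget. [cite: Balaban1987RG1, Thm 2 p.259 (first sentence) and (2.12)–(2.14) p.268] -/
theorem endPossibleLin_perturb' (hC : 0 ≤ C) {γ₀ : ℝ} (hγ₀ : 0 < γ₀) {δ : ℕ → ℝ} (hδ : ∀ j, 0 ≤ δ j) {D : ℝ}
    (hD : ∀ n, ∑ j ∈ range n, δ j ≤ D) (h : EndPossibleLin b C γ₀) : EndPossibleLin (fun i => b i - δ i) C γ₀ := by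
  rw [endPossibleLin_iff_barrier hC hγ₀] at h ⊢
  intro A hA
  have hD0 : 0 ≤ D := le_trans (by simp) (hD 0)
  obtain ⟨Y, ℓ, hℓ⟩ := h (A + D) (by linarith)
  exact ⟨Y, _, hℓ.perturb hC hA hδ hD⟩

/-! ## §6 (v1.2, append-only) Two extreme barriers: the constant floor, and a bounded forward orbit -/
/-- **THE CONSTANT BARRIER** · the constant sequence `Y ≥ A` is a barrier for `(b, C)` between `A` and `Y` iff the floor condition `−b_i ≤ C∕√Y` holds at
EVERY index (a uniform floor for the whole sequence, not only a tail). [folklore] -/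
theorem isBarrier_const_iff {A Y : ℝ} (hAY : A ≤ Y) : IsBarrier b C A Y (fun _ => Y) ↔ ∀ i, -b i ≤ C / Real.sqrt Y := by
  constructor
  · intro h i; have := h.2.2 i; linarith
  · intro h; exact ⟨fun _ => hAY, fun _ => le_rfl, fun i => by linarith [h i]⟩

/-- **A BOUNDED FORWARD ORBIT IS A BARRIER** · a helped forward orbit staying in `[A, Y]` for ever is itself a barrier (the equality case) — excluded for
the octal staircase on both sides of its threshold, where only the lower envelope of shooting orbits is bounded (`barrier_of_orbitsAbove`). [folklore] -/
theorem IsBarrier.of_fwdOrbit {A Y x₀ : ℝ} (hlow : ∀ i, A ≤ fwdOrbit b C x₀ i) (hup : ∀ i, fwdOrbit b C x₀ i ≤ Y) :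
    IsBarrier b C A Y (fwdOrbit b C x₀) :=
  ⟨hlow, hup, fun i => by rw [fwdOrbit_succ]⟩

end

end Summit.QuantumFields.BalabanUV.Gaps.EndDrawdownLinearBarrier
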